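import Mathlib
import HarnessLib
import Literature.MathematicalPhysics.QuantumLattice.HubbardUVSymbolFrameShiftDecay
import Literature.MathematicalPhysics.QuantumLattice.MatsubaraTruncationMidpoint
import Summits.HubbardSuperconductivity.HubbardSuperconductivity.Theorems.KLProgrammeKLRegimeEngineFrameShiftSymbolL1Sharp
import Summits.HubbardSuperconductivity.HubbardSuperconductivity.Theorems.KLProgrammeKLRegimeEngineMatsubaraDensityDerivative

/-!
# K3 gen-8-FLOW (stmt 20437 `KLRegimeEngineV17F2`, stub (C), located risk «(C)-B-REP», item (γ-b)): the SIGNED ultraviolet-density response of the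
# one-shot symbol — `‖Σ_{(ω,k⃗)} (Ψ_{K₁} − Ψ_{K₀})((ω,k⃗),σ)‖ ≤ βL²·fd·[16(2B₁+1)β(c₁L² + c₂L/(2Λ)) + L²β²/(2π²M) + (16π²/β)(2c₁L²/(3Λ²) + c₂L/(7Λ³) + L²/(2^{J+1}Λ)³)]`

Cell gate-hubbard-kl, seat p2 g12; pen ruling (R59c) «(γ) … + signed UV-density response under a DOS hypothesis `hDOS`»; design = evidence
`GAMMA-B-DESIGN-p2g12.md` on 20437.  This is the FIRST-ORDER (bare-vertex tadpole) input of the corrected (B) door (memo B-DOOR-LAW-p2g12 §3): the bare vertex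
`U` contracted with the covariance difference `Ċ = C^{K₁}_{>Λ} − C^{K₀}_{>Λ}` is `U × Σ_{(ω,k⃗)} ΔΨ`, a SIGNED sum.  With absolute values (`…SymbolL1Sharp`, p556615)
it is `O(βL²·β·fd·L²·log(η₀/Λ))`; signed, the frequency sum is done FIRST:

* §1 `sum_resolventFn_matsubara_eq`, `sum_uvSymbolFn_matsubara_eq_of_le` — above the shell (`Λ ≤ |e|`, weight `≡ 1`) the summed symbol is REAL:
  `Σ_i Ψ_e(ω_i) = c·T(e)`, `T(e) = Σ_i e/(ω_i² + e²)` (`sum_inv_I_mul_matsubaraFreq_sub`: the odd part cancels);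
* §2 `hasDerivAt_truncDensity`, `abs_truncDensity_sub_le` — `T′ = Σ_i (ω_i²−e²)/(ω_i²+e²)²`, and by `…MatsubaraDensityDerivative.abs_sum_matsubaraIdx_densityDeriv_le`
  (the MIDPOINT structure of the fermionic frequencies) `|T(e₁) − T(e₀)| ≤ |e₁−e₀|·(β²/(2π²M) + 2π²/(βd³))` on segments with `|e| ≥ d > 0` — no `β/|e|`, no log;
* §3 `sum_inv_cube_le_of_count` — the dyadic count `Σ_{v ≥ 2Λ} 1/v³ ≤ 2c₁V/(3Λ²) + C₂/(7Λ³) + T/(2^{J+1}Λ)³` under `#{v < η} ≤ c₁Vη + C₂` (`η ≤ η₀`, `2^{J+1}Λ ≤ η₀`);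
* §4 **`norm_sum_uvSymbolCT_sub_le_signed`** — momenta with `|e_{K₀}| < 2Λ` by the shell bound (`norm_uvSymbolCT_sub_le_decay` + `sum_matsubaraIdx_inv_max_sq_le`,
  `≤ 8(2B₁+1)βL²·fd·β/Λ` each, count `≤ 2c₁L²Λ + c₂L`), momenta with `|e_{K₀}| ≥ 2Λ` by §1–§3 (`d = |e_{K₀}| − fd ≥ |e_{K₀}|/2`).
  On the extended ladder (`βΛ_n ≥ π/4`, `M ≥ β`) every bracket term is `O(β·c₁L²)`: the bare tadpole of the corrected door is `O(U·ν̄·frameDist)` — a pure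
  smallness condition on `U`, uniform in the scale.

Proofs only; no definitions; `hDOS` is an explicit hypothesis (shape of `…FrameShellCount.card_frameLevel_lt_le`); nothing asserts superconductivity.
References: BGM 2006 §2.1 (2.2)–(2.5), §2.2 (2.36aa) [cite: BenfattoGiulianiMastropietro2006]; Giuliani–Mastropietro 2010 App. A (A.19)–(A.21).
-/

noncomputable section

namespace Summit.HubbardSuperconductivity.HubbardSuperconductivity.Theorems.EngineV8

set_option linter.dupNamespace false -- summit = problem name (single-conjunct summit), D-0017

open Finset Real Literature.MathematicalPhysics.QuantumLattice Literature.Probability.LatticeModels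

/-! ## §1 Above the shell the summed symbol is real -/

/-- **`Σ_i c/(−iω_i + e) = c·Σ_i e/(ω_i² + e²)`** (the odd part cancels over the symmetric frequency set). -/
theorem sum_resolventFn_matsubara_eq (β c e : ℝ) (M : ℕ) :
    ∑ i : MatsubaraIdx M, resolventFn c 0 e (matsubaraFreq β M i) =
      ((c * ∑ i : MatsubaraIdx M, e / (matsubaraFreq β M i ^ 2 + e ^ 2) : ℝ) : ℂ) := by
  have h := sum_inv_I_mul_matsubaraFreq_sub β M e
  have hterm : ∀ i : MatsubaraIdx M, resolventFn c 0 e (matsubaraFreq β M i) =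
      -(c : ℂ) * ((1 : ℂ) / (Complex.I * (matsubaraFreq β M i : ℂ) - e)) := by
    intro i
    rw [resolventFn, add_zero, mul_one_div]
    have : (-Complex.I * ((matsubaraFreq β M i : ℝ) : ℂ) + (e : ℂ)) = -(Complex.I * (matsubaraFreq β M i : ℂ) - e) := by ring
    rw [this, div_neg, neg_div]
  simp_rw [hterm]
  rw [← mul_sum, h]
  push_cast
  rw [mul_sum, mul_sum]
  refine sum_congr rfl fun i _ => ?_
  ring

/-- **Above the shell the summed symbol is `c·T(e)`**: for `Λ ≤ |e|` (`0 < β`, `0 < Λ`) the weight is `1` at every frequency and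
`Σ_i Ψ_e(ω_i) = c·Σ_i e/(ω_i² + e²)`. -/
theorem sum_uvSymbolFn_matsubara_eq_of_le {β : ℝ} (hβ : 0 < β) {Λ : ℝ} (hΛ : 0 < Λ) (c : ℝ) {e : ℝ} (he : Λ ≤ |e|) (M : ℕ) :
    ∑ i : MatsubaraIdx M, uvSymbolFn c Λ e (matsubaraFreq β M i) =
      ((c * ∑ i : MatsubaraIdx M, e / (matsubaraFreq β M i ^ 2 + e ^ 2) : ℝ) : ℂ) := by
  have hW : ∀ i : MatsubaraIdx M, uvWeightFn Λ e (matsubaraFreq β M i) = 1 := by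
    intro i
    have hω : 0 < matsubaraFreq β M i ^ 2 := by
      have := matsubaraFreq_ne_zero hβ.ne' i
      positivity
    have he2 : Λ ^ 2 ≤ e ^ 2 := by
      calc Λ ^ 2 ≤ |e| ^ 2 := pow_le_pow_left₀ hΛ.le he 2
        _ = e ^ 2 := sq_abs e
    exact (uvWeightFn_eq_one_of_gt hΛ (e := e) (ω := matsubaraFreq β M i) (by linarith)).1
  have hterm : ∀ i : MatsubaraIdx M, uvSymbolFn c Λ e (matsubaraFreq β M i) = resolventFn c 0 e (matsubaraFreq β M i) := by
    intro i; rw [uvSymbolFn, hW i, Complex.ofReal_one, one_mul]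
  simp_rw [hterm]
  exact sum_resolventFn_matsubara_eq β c e M

/-! ## §2 The truncated density `T(e) = Σ_i e/(ω_i² + e²)` and its increments -/

/-- `T` is differentiable with `T′(e) = Σ_i (ω_i² − e²)/(ω_i² + e²)²` (`β ≠ 0`: no frequency vanishes). -/
theorem hasDerivAt_truncDensity {β : ℝ} (hβ : β ≠ 0) (M : ℕ) (e : ℝ) :
    HasDerivAt (fun x : ℝ => ∑ i : MatsubaraIdx M, x / (matsubaraFreq β M i ^ 2 + x ^ 2))
      (∑ i : MatsubaraIdx M, (matsubaraFreq β M i ^ 2 - e ^ 2) / (matsubaraFreq β M i ^ 2 + e ^ 2) ^ 2) e := by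
  refine HasDerivAt.fun_sum fun i _ => ?_
  have hω : 0 < matsubaraFreq β M i ^ 2 := by
    have := matsubaraFreq_ne_zero hβ i
    positivity
  have hden : matsubaraFreq β M i ^ 2 + e ^ 2 ≠ 0 := by positivity
  have hd : HasDerivAt (fun x : ℝ => matsubaraFreq β M i ^ 2 + x ^ 2) (2 * e) e := by
    have := ((hasDerivAt_id e).pow 2).const_add (matsubaraFreq β M i ^ 2)
    simpa using this
  have h := (hasDerivAt_id' e).fun_div hd hden
  refine h.congr_deriv ?_
  field_simp
  ring

/-- **Increments of the truncated density away from the Fermi surface**: on a segment `[e₀, e₁]` with `|e| ≥ d > 0` throughout (`0 < β`, `1 ≤ M`),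
`|T(e₁) − T(e₀)| ≤ |e₁ − e₀|·(β²/(2π²M) + 2π²/(β·d³))`. -/
theorem abs_truncDensity_sub_le {β : ℝ} (hβ : 0 < β) {M : ℕ} (hM : 1 ≤ M) (e₀ e₁ : ℝ) {d : ℝ} (hd : 0 < d)
    (hseg : ∀ e ∈ Set.uIcc e₀ e₁, d ≤ |e|) :
    |(∑ i : MatsubaraIdx M, e₁ / (matsubaraFreq β M i ^ 2 + e₁ ^ 2)) - ∑ i : MatsubaraIdx M, e₀ / (matsubaraFreq β M i ^ 2 + e₀ ^ 2)| ≤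
      |e₁ - e₀| * (β ^ 2 / (2 * π ^ 2 * M) + 2 * π ^ 2 / (β * d ^ 3)) := by
  have hbound : ∀ e ∈ Set.uIcc e₀ e₁,
      ‖∑ i : MatsubaraIdx M, (matsubaraFreq β M i ^ 2 - e ^ 2) / (matsubaraFreq β M i ^ 2 + e ^ 2) ^ 2‖ ≤
        β ^ 2 / (2 * π ^ 2 * M) + 2 * π ^ 2 / (β * d ^ 3) := by
    intro e he
    have hde : d ≤ |e| := hseg e he
    have he0 : e ≠ 0 := by
      intro h0; rw [h0, abs_zero] at hde; linarith
    rw [Real.norm_eq_abs]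
    refine (abs_sum_matsubaraIdx_densityDeriv_le hβ hM he0).trans (add_le_add le_rfl ?_)
    exact div_le_div_of_nonneg_left (by positivity) (by positivity)
      (mul_le_mul_of_nonneg_left (pow_le_pow_left₀ hd.le hde 3) hβ.le)
  have h := Convex.norm_image_sub_le_of_norm_hasDerivWithin_le
    (f := fun x : ℝ => ∑ i : MatsubaraIdx M, x / (matsubaraFreq β M i ^ 2 + x ^ 2))
    (fun x _ => (hasDerivAt_truncDensity hβ.ne' M x).hasDerivWithinAt) hbound (convex_uIcc e₀ e₁) Set.left_mem_uIcc Set.right_mem_uIcc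
  rw [Real.norm_eq_abs, Real.norm_eq_abs] at h
  simpa [mul_comm] using h

/-! ## §3 The dyadic count of `Σ_{v ≥ 2Λ} 1/v³` -/

section Count

variable {ι : Type*} [Fintype ι]

/-- **Pointwise dyadic majorant for `[2Λ ≤ v]/v³`**: `≤ Σ_{j<J}[2^{j+1}Λ ≤ v < 2^{j+2}Λ]/(2^{j+1}Λ)³ + [2^{J+1}Λ ≤ v]/(2^{J+1}Λ)³`. -/
theorem ind_div_cube_le_dyadic {Λ : ℝ} (hΛ : 0 < Λ) (J : ℕ) (v : ℝ) :
    (if 2 * Λ ≤ v then 1 / v ^ 3 else 0) ≤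
      (∑ j ∈ range J, if (2 : ℝ) ^ (j + 1) * Λ ≤ v ∧ v < (2 : ℝ) ^ (j + 2) * Λ then 1 / ((2 : ℝ) ^ (j + 1) * Λ) ^ 3 else 0) +
        (if (2 : ℝ) ^ (J + 1) * Λ ≤ v then 1 / ((2 : ℝ) ^ (J + 1) * Λ) ^ 3 else 0) := by
  have hsum0 : 0 ≤ ∑ j ∈ range J, (if (2 : ℝ) ^ (j + 1) * Λ ≤ v ∧ v < (2 : ℝ) ^ (j + 2) * Λ then 1 / ((2 : ℝ) ^ (j + 1) * Λ) ^ 3 else 0) :=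
    sum_nonneg fun j _ => by split_ifs <;> positivity
  have htop0 : 0 ≤ (if (2 : ℝ) ^ (J + 1) * Λ ≤ v then 1 / ((2 : ℝ) ^ (J + 1) * Λ) ^ 3 else 0) := by split_ifs <;> positivity
  by_cases hv : 2 * Λ ≤ v
  · rw [if_pos hv]
    have hv0 : 0 < v := by linarith
    by_cases htop : (2 : ℝ) ^ (J + 1) * Λ ≤ v
    · rw [if_pos htop]
      have : 1 / v ^ 3 ≤ 1 / ((2 : ℝ) ^ (J + 1) * Λ) ^ 3 :=
        one_div_le_one_div_of_le (by positivity) (pow_le_pow_left₀ (by positivity) htop 3)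
      linarith
    · rw [if_neg htop, add_zero]
      have hx : 1 ≤ v / (2 * Λ) := by rw [le_div_iff₀ (by positivity), one_mul]; exact hv
      obtain ⟨n, hn1, hn2⟩ := exists_nat_pow_near hx (show (1 : ℝ) < 2 by norm_num)
      have hn1' : (2 : ℝ) ^ (n + 1) * Λ ≤ v := by
        rw [le_div_iff₀ (by positivity)] at hn1; rw [pow_succ]; linarith
      have hn2' : v < (2 : ℝ) ^ (n + 2) * Λ := by
        rw [div_lt_iff₀ (by positivity)] at hn2; rw [pow_succ, pow_succ] at *; linarith
      have hnJ : n < J := by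
        by_contra hge
        have hge' : J ≤ n := not_lt.1 hge
        have : (2 : ℝ) ^ (J + 1) * Λ ≤ (2 : ℝ) ^ (n + 1) * Λ :=
          mul_le_mul_of_nonneg_right (pow_le_pow_right₀ (by norm_num) (by omega)) hΛ.le
        exact htop (this.trans hn1')
      have hterm : 1 / ((2 : ℝ) ^ (n + 1) * Λ) ^ 3 ≤
          ∑ j ∈ range J, (if (2 : ℝ) ^ (j + 1) * Λ ≤ v ∧ v < (2 : ℝ) ^ (j + 2) * Λ then 1 / ((2 : ℝ) ^ (j + 1) * Λ) ^ 3 else 0) := by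
        have h := single_le_sum (f := fun j => (if (2 : ℝ) ^ (j + 1) * Λ ≤ v ∧ v < (2 : ℝ) ^ (j + 2) * Λ then
          1 / ((2 : ℝ) ^ (j + 1) * Λ) ^ 3 else 0)) (fun j _ => by split_ifs <;> positivity) (mem_range.mpr hnJ)
        simp only [hn1', hn2', and_self, if_true] at h
        exact h
      have h1 : 1 / v ^ 3 ≤ 1 / ((2 : ℝ) ^ (n + 1) * Λ) ^ 3 :=
        one_div_le_one_div_of_le (by positivity) (pow_le_pow_left₀ (by positivity) hn1' 3)
      linarith
  · rw [if_neg hv]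
    linarith

/-- **The dyadic count**: `#{v < η} ≤ c₁V·η + C₂` for `0 < η ≤ η₀` (`c₁V, C₂ ≥ 0`), `0 < Λ`, `2^{J+1}Λ ≤ η₀` ⟹
`Σ_k [2Λ ≤ v_k]/v_k³ ≤ 2c₁V/(3Λ²) + C₂/(7Λ³) + (#ι)/(2^{J+1}Λ)³`. -/
theorem sum_inv_cube_le_of_count (v : ι → ℝ) {Λ η₀ c₁V C₂ : ℝ} (hΛ : 0 < Λ) (hc₁ : 0 ≤ c₁V) (hC₂ : 0 ≤ C₂) (J : ℕ)
    (hJ : (2 : ℝ) ^ (J + 1) * Λ ≤ η₀)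
    (hcount : ∀ η : ℝ, 0 < η → η ≤ η₀ → ((univ.filter fun k => v k < η).card : ℝ) ≤ c₁V * η + C₂) :
    ∑ k, (if 2 * Λ ≤ v k then 1 / v k ^ 3 else 0) ≤
      2 * c₁V / (3 * Λ ^ 2) + C₂ / (7 * Λ ^ 3) + (Fintype.card ι : ℝ) / ((2 : ℝ) ^ (J + 1) * Λ) ^ 3 := by
  classical
  refine (sum_le_sum fun k _ => ind_div_cube_le_dyadic hΛ J (v k)).trans ?_
  rw [sum_add_distrib, sum_ite_const_zero, sum_comm]
  simp_rw [sum_ite_const_zero]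
  -- shells
  have hshell : ∀ j ∈ range J, ((univ.filter fun k => (2 : ℝ) ^ (j + 1) * Λ ≤ v k ∧ v k < (2 : ℝ) ^ (j + 2) * Λ).card : ℝ) ≤
      c₁V * ((2 : ℝ) ^ (j + 2) * Λ) + C₂ := by
    intro j hj
    have hjJ : j + 2 ≤ J + 1 := by have := mem_range.mp hj; omega
    have hη : (2 : ℝ) ^ (j + 2) * Λ ≤ η₀ :=
      le_trans (mul_le_mul_of_nonneg_right (pow_le_pow_right₀ (by norm_num) hjJ) hΛ.le) hJ
    refine le_trans ?_ (hcount _ (by positivity) hη)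
    exact_mod_cast card_le_card (fun k hk => by
      simp only [mem_filter, mem_univ, true_and] at hk ⊢
      exact hk.2)
  have htop : ((univ.filter fun k => (2 : ℝ) ^ (J + 1) * Λ ≤ v k).card : ℝ) ≤ Fintype.card ι := by
    exact_mod_cast (card_le_card (filter_subset _ _)).trans (card_univ (α := ι)).le
  have hterm : ∀ j ∈ range J, 1 / ((2 : ℝ) ^ (j + 1) * Λ) ^ 3 *
      ((univ.filter fun k => (2 : ℝ) ^ (j + 1) * Λ ≤ v k ∧ v k < (2 : ℝ) ^ (j + 2) * Λ).card : ℝ) ≤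
      c₁V / (2 * Λ ^ 2) * ((4 : ℝ)⁻¹) ^ j + C₂ / (8 * Λ ^ 3) * ((8 : ℝ)⁻¹) ^ j := by
    intro j hj
    calc _ ≤ 1 / ((2 : ℝ) ^ (j + 1) * Λ) ^ 3 * (c₁V * ((2 : ℝ) ^ (j + 2) * Λ) + C₂) :=
          mul_le_mul_of_nonneg_left (hshell j hj) (by positivity)
      _ = c₁V / (2 * Λ ^ 2) * ((4 : ℝ)⁻¹) ^ j + C₂ / (8 * Λ ^ 3) * ((8 : ℝ)⁻¹) ^ j := by
          have h2 : (2 : ℝ) ^ j ≠ 0 := pow_ne_zero _ (by norm_num)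
          rw [inv_pow, inv_pow, show (4 : ℝ) ^ j = (2 : ℝ) ^ j * (2 : ℝ) ^ j by rw [← mul_pow]; norm_num,
            show (8 : ℝ) ^ j = (2 : ℝ) ^ j * (2 : ℝ) ^ j * (2 : ℝ) ^ j by rw [← mul_pow, ← mul_pow]; norm_num]
          field_simp
          ring
  have hg4 : ∑ j ∈ range J, ((4 : ℝ)⁻¹) ^ j ≤ 4 / 3 := by
    have := geom_sum_Ico_le_of_lt_one (show (0 : ℝ) ≤ 4⁻¹ by norm_num) (show (4 : ℝ)⁻¹ < 1 by norm_num) (m := 0) (n := J)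
    rw [range_eq_Ico]; refine this.trans (le_of_eq ?_); norm_num
  have hg8 : ∑ j ∈ range J, ((8 : ℝ)⁻¹) ^ j ≤ 8 / 7 := by
    have := geom_sum_Ico_le_of_lt_one (show (0 : ℝ) ≤ 8⁻¹ by norm_num) (show (8 : ℝ)⁻¹ < 1 by norm_num) (m := 0) (n := J)
    rw [range_eq_Ico]; refine this.trans (le_of_eq ?_); norm_num
  have h2 : ∑ j ∈ range J, 1 / ((2 : ℝ) ^ (j + 1) * Λ) ^ 3 *
      ((univ.filter fun k => (2 : ℝ) ^ (j + 1) * Λ ≤ v k ∧ v k < (2 : ℝ) ^ (j + 2) * Λ).card : ℝ) ≤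
      2 * c₁V / (3 * Λ ^ 2) + C₂ / (7 * Λ ^ 3) := by
    refine (sum_le_sum hterm).trans ?_
    rw [sum_add_distrib, ← mul_sum, ← mul_sum]
    have ha : c₁V / (2 * Λ ^ 2) * ∑ j ∈ range J, ((4 : ℝ)⁻¹) ^ j ≤ c₁V / (2 * Λ ^ 2) * (4 / 3) :=
      mul_le_mul_of_nonneg_left hg4 (by positivity)
    have hb : C₂ / (8 * Λ ^ 3) * ∑ j ∈ range J, ((8 : ℝ)⁻¹) ^ j ≤ C₂ / (8 * Λ ^ 3) * (8 / 7) :=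
      mul_le_mul_of_nonneg_left hg8 (by positivity)
    have e1 : c₁V / (2 * Λ ^ 2) * (4 / 3) = 2 * c₁V / (3 * Λ ^ 2) := by ring
    have e2 : C₂ / (8 * Λ ^ 3) * (8 / 7) = C₂ / (7 * Λ ^ 3) := by ring
    linarith
  have h3 : 1 / ((2 : ℝ) ^ (J + 1) * Λ) ^ 3 * ((univ.filter fun k => (2 : ℝ) ^ (J + 1) * Λ ≤ v k).card : ℝ) ≤
      (Fintype.card ι : ℝ) / ((2 : ℝ) ^ (J + 1) * Λ) ^ 3 := by
    rw [one_div_mul_eq_div]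
    exact div_le_div_of_nonneg_right htop (by positivity)
  linarith

end Count

/-! ## §4 The signed ultraviolet-density response -/

section Model

variable {L M : ℕ} [NeZero L]

/-- **THE SIGNED ULTRAVIOLET-DENSITY RESPONSE OF THE ONE-SHOT SYMBOL.**  For two frames `K₀, K₁` with `|K₁(p) − K₀(p)| ≤ fd ≤ Λ` and the counting law
`hDOS` of `e_{K₀}` on the torus grid (`2^{J+1}·Λ ≤ η₀`), `0 < β`, `1 ≤ M`, at every spin `σ`:
`‖Σ_{(i,k⃗)} (Ψ_{K₁} − Ψ_{K₀})((i,k⃗),σ)‖ ≤ βL²·fd·[16(2B₁+1)·β·(c₁L² + c₂L/(2Λ)) + L²β²/(2π²M) + (16π²/β)·(2c₁L²/(3Λ²) + c₂L/(7Λ³) + L²/(2^{J+1}Λ)³)]`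
— momenta in the shell region `|e_{K₀}| < 2Λ` by the absolute bound, the rest by the frequency sum done FIRST (real, midpoint-accurate). -/
theorem norm_sum_uvSymbolCT_sub_le_signed {B₁ : ℝ} (hB₁ : ∀ y, |deriv salmhoferCutoff y| ≤ B₁) {β : ℝ} (hβ : 0 < β)
    [NeZero M] (hM : 1 ≤ M) {Λ : ℝ} (hΛ : 0 < Λ)
    (μ : ℝ) (K₀ K₁ : TrigPolyC4v) {fd : ℝ} (hfd0 : 0 ≤ fd) (hfdΛ : fd ≤ Λ)
    (hfd : ∀ kv : TorusSite 2 L, |K₁.eval (latticeMomentum L kv) - K₀.eval (latticeMomentum L kv)| ≤ fd)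
    {η₀ c₁ c₂ : ℝ} (hc₁ : 0 ≤ c₁) (hc₂ : 0 ≤ c₂) (J : ℕ) (hJ : (2 : ℝ) ^ (J + 1) * Λ ≤ η₀)
    (hDOS : ∀ η : ℝ, 0 < η → η ≤ η₀ →
      ((univ.filter fun kv : TorusSite 2 L => |nambuXiCT L μ K₀ kv| < η).card : ℝ) ≤ c₁ * (L : ℝ) ^ 2 * η + c₂ * L) (σ : Fin 2) :
    ‖∑ p : FreqMomentum L M, (uvSymbolCT L M β μ K₁ Λ (p, σ) - uvSymbolCT L M β μ K₀ Λ (p, σ))‖ ≤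
      (β * (L : ℝ) ^ 2) * fd *
        (16 * (2 * B₁ + 1) * β * (c₁ * (L : ℝ) ^ 2 + c₂ * L / (2 * Λ)) + (L : ℝ) ^ 2 * β ^ 2 / (2 * π ^ 2 * M) +
          16 * π ^ 2 / β * (2 * (c₁ * (L : ℝ) ^ 2) / (3 * Λ ^ 2) + c₂ * L / (7 * Λ ^ 3) + (L : ℝ) ^ 2 / ((2 : ℝ) ^ (J + 1) * Λ) ^ 3)) := by
  classical
  have hB10 : 0 ≤ B₁ := (abs_nonneg _).trans (hB₁ 0)
  have hL : (0 : ℝ) < L := by exact_mod_cast NeZero.pos L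
  set c : ℝ := β * (L : ℝ) ^ 2 with hc
  have hc0 : 0 < c := by positivity
  set e₀ : TorusSite 2 L → ℝ := fun kv => nambuXiCT L μ K₀ kv with he₀
  set e₁ : TorusSite 2 L → ℝ := fun kv => nambuXiCT L μ K₁ kv with he₁
  have hδ : ∀ kv, |e₁ kv - e₀ kv| ≤ fd := by
    intro kv
    have : e₁ kv - e₀ kv = -(K₁.eval (latticeMomentum L kv) - K₀.eval (latticeMomentum L kv)) := by
      simp only [he₀, he₁, nambuXiCT]; ring
    rw [this, abs_neg]; exact hfd kv
  -- per-momentum frequency sums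
  set G : TorusSite 2 L → ℂ := fun kv => ∑ i : MatsubaraIdx M,
    (uvSymbolCT L M β μ K₁ Λ ((i, kv), σ) - uvSymbolCT L M β μ K₀ Λ ((i, kv), σ)) with hG
  have hsplit : ∑ p : FreqMomentum L M, (uvSymbolCT L M β μ K₁ Λ (p, σ) - uvSymbolCT L M β μ K₀ Λ (p, σ)) =
      ∑ kv : TorusSite 2 L, G kv := by
    rw [Fintype.sum_prod_type, sum_comm]
  rw [hsplit]
  -- (B) the shell region: absolute bound per momentum
  have hshellpt : ∀ kv, ‖G kv‖ ≤ 8 * (2 * B₁ + 1) * c * fd * β / Λ := by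
    intro kv
    refine (norm_sum_le _ _).trans ?_
    have hmode : ∀ i : MatsubaraIdx M, ‖uvSymbolCT L M β μ K₁ Λ ((i, kv), σ) - uvSymbolCT L M β μ K₀ Λ ((i, kv), σ)‖ ≤
        4 * ((2 * B₁ + 1) * c) * fd * (1 / max (matsubaraFreq β M i ^ 2 + 0 ^ 2) (Λ ^ 2 / 4)) := by
      intro i
      have h := norm_uvSymbolCT_sub_le_decay (L := L) (M := M) hB₁ hβ hΛ μ K₁ K₀ i kv σ
      set dd := max (|nambuXiCT L μ K₀ kv| - |K₁.eval (latticeMomentum L kv) - K₀.eval (latticeMomentum L kv)|) 0 with hdd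
      have hmx0 : 0 < max (matsubaraFreq β M i ^ 2 + 0 ^ 2) (Λ ^ 2 / 4) := lt_max_of_lt_right (by positivity)
      have hmono : 1 / max (matsubaraFreq β M i ^ 2 + dd ^ 2) (Λ ^ 2 / 4) ≤ 1 / max (matsubaraFreq β M i ^ 2 + 0 ^ 2) (Λ ^ 2 / 4) :=
        one_div_le_one_div_of_le hmx0 (max_le_max (by nlinarith [sq_nonneg dd]) le_rfl)
      calc _ ≤ 4 * ((2 * B₁ + 1) * c) / max (matsubaraFreq β M i ^ 2 + dd ^ 2) (Λ ^ 2 / 4) *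
            |K₁.eval (latticeMomentum L kv) - K₀.eval (latticeMomentum L kv)| := h
        _ = 4 * ((2 * B₁ + 1) * c) * |K₁.eval (latticeMomentum L kv) - K₀.eval (latticeMomentum L kv)| *
            (1 / max (matsubaraFreq β M i ^ 2 + dd ^ 2) (Λ ^ 2 / 4)) := by ring
        _ ≤ 4 * ((2 * B₁ + 1) * c) * fd * (1 / max (matsubaraFreq β M i ^ 2 + 0 ^ 2) (Λ ^ 2 / 4)) :=
            mul_le_mul (mul_le_mul_of_nonneg_left (hfd kv) (by positivity)) hmono (by positivity) (by positivity)
    have hfreq := sum_matsubaraIdx_inv_max_sq_le hβ hΛ (le_refl (0 : ℝ)) M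
    rw [max_eq_right (by positivity : (0 : ℝ) ≤ Λ / 2)] at hfreq
    calc ∑ i : MatsubaraIdx M, ‖uvSymbolCT L M β μ K₁ Λ ((i, kv), σ) - uvSymbolCT L M β μ K₀ Λ ((i, kv), σ)‖
        ≤ ∑ i : MatsubaraIdx M, 4 * ((2 * B₁ + 1) * c) * fd * (1 / max (matsubaraFreq β M i ^ 2 + 0 ^ 2) (Λ ^ 2 / 4)) :=
          sum_le_sum fun i _ => hmode i
      _ = 4 * ((2 * B₁ + 1) * c) * fd * ∑ i : MatsubaraIdx M, 1 / max (matsubaraFreq β M i ^ 2 + 0 ^ 2) (Λ ^ 2 / 4) := by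
          rw [mul_sum]
      _ ≤ 4 * ((2 * B₁ + 1) * c) * fd * (β / (Λ / 2)) := mul_le_mul_of_nonneg_left hfreq (by positivity)
      _ = 8 * (2 * B₁ + 1) * c * fd * β / Λ := by field_simp; ring
  -- (A) the far region: the frequency sum first
  have hfarpt : ∀ kv, 2 * Λ ≤ |e₀ kv| →
      ‖G kv‖ ≤ c * fd * (β ^ 2 / (2 * π ^ 2 * M) + 2 * π ^ 2 / (β * (|e₀ kv| / 2) ^ 3)) := by
    intro kv hfar
    have hΛ0 : Λ ≤ |e₀ kv| := by linarith
    have hΛ1 : Λ ≤ |e₁ kv| := by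
      have := abs_sub_abs_le_abs_sub (e₀ kv) (e₁ kv)
      rw [abs_sub_comm] at this
      linarith [hδ kv]
    have hG' : G kv = ((c * ∑ i : MatsubaraIdx M, e₁ kv / (matsubaraFreq β M i ^ 2 + e₁ kv ^ 2) : ℝ) : ℂ) -
        ((c * ∑ i : MatsubaraIdx M, e₀ kv / (matsubaraFreq β M i ^ 2 + e₀ kv ^ 2) : ℝ) : ℂ) := by
      rw [hG]
      simp only
      rw [sum_sub_distrib]
      simp_rw [uvSymbolCT_eq_uvSymbolFn hβ]
      rw [sum_uvSymbolFn_matsubara_eq_of_le hβ hΛ c hΛ1 M, sum_uvSymbolFn_matsubara_eq_of_le hβ hΛ c hΛ0 M]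
    rw [hG', ← Complex.ofReal_sub, Complex.norm_real, Real.norm_eq_abs, ← mul_sub, abs_mul, abs_of_pos hc0]
    have hdpos : 0 < |e₀ kv| / 2 := by linarith
    have hseg : ∀ e ∈ Set.uIcc (e₀ kv) (e₁ kv), |e₀ kv| / 2 ≤ |e| := by
      intro e he
      have h1 : |e - e₀ kv| ≤ |e₁ kv - e₀ kv| := Set.abs_sub_left_of_mem_uIcc he
      have h2 : |e₀ kv| - |e - e₀ kv| ≤ |e| := by
        have := abs_sub_abs_le_abs_sub (e₀ kv) e
        rw [abs_sub_comm] at this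
        linarith
      linarith [hδ kv]
    have hT := abs_truncDensity_sub_le hβ hM (e₀ kv) (e₁ kv) hdpos hseg
    calc c * |(∑ i : MatsubaraIdx M, e₁ kv / (matsubaraFreq β M i ^ 2 + e₁ kv ^ 2)) -
          ∑ i : MatsubaraIdx M, e₀ kv / (matsubaraFreq β M i ^ 2 + e₀ kv ^ 2)|
        ≤ c * (|e₁ kv - e₀ kv| * (β ^ 2 / (2 * π ^ 2 * M) + 2 * π ^ 2 / (β * (|e₀ kv| / 2) ^ 3))) :=
          mul_le_mul_of_nonneg_left hT hc0.le
      _ ≤ c * (fd * (β ^ 2 / (2 * π ^ 2 * M) + 2 * π ^ 2 / (β * (|e₀ kv| / 2) ^ 3))) :=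
          mul_le_mul_of_nonneg_left (mul_le_mul_of_nonneg_right (hδ kv) (by positivity)) hc0.le
      _ = _ := by ring
  -- pointwise majorant combining the two regions
  have hpt : ∀ kv, ‖G kv‖ ≤ (if |e₀ kv| < 2 * Λ then 8 * (2 * B₁ + 1) * c * fd * β / Λ else 0) +
      (c * fd * (β ^ 2 / (2 * π ^ 2 * M))) * (if 2 * Λ ≤ |e₀ kv| then 1 else 0) +
      (c * fd * (16 * π ^ 2 / β)) * (if 2 * Λ ≤ |e₀ kv| then 1 / |e₀ kv| ^ 3 else 0) := by
    intro kv
    by_cases hnear : |e₀ kv| < 2 * Λ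
    · rw [if_pos hnear, if_neg (not_le.2 hnear), if_neg (not_le.2 hnear), mul_zero, mul_zero, add_zero, add_zero]
      exact hshellpt kv
    · have hfar : 2 * Λ ≤ |e₀ kv| := not_lt.1 hnear
      rw [if_neg hnear, if_pos hfar, if_pos hfar, zero_add, mul_one]
      refine (hfarpt kv hfar).trans (le_of_eq ?_)
      have hne : |e₀ kv| ≠ 0 := by linarith
      field_simp
      ring
  refine (norm_sum_le _ _).trans ((sum_le_sum fun kv _ => hpt kv).trans ?_)
  rw [sum_add_distrib, sum_add_distrib, sum_ite_const_zero, ← mul_sum, ← mul_sum, sum_ite_const_zero, one_mul]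
  -- the three counts
  have hΛη : 2 * Λ ≤ η₀ := le_trans (by
    have : (2 : ℝ) ≤ (2 : ℝ) ^ (J + 1) := by
      calc (2 : ℝ) = 2 ^ 1 := by norm_num
        _ ≤ 2 ^ (J + 1) := pow_le_pow_right₀ (by norm_num) (by omega)
    nlinarith) hJ
  have hnear : ((univ.filter fun kv : TorusSite 2 L => |e₀ kv| < 2 * Λ).card : ℝ) ≤ c₁ * (L : ℝ) ^ 2 * (2 * Λ) + c₂ * L :=
    hDOS (2 * Λ) (by positivity) hΛη
  have hfarcount : ((univ.filter fun kv : TorusSite 2 L => 2 * Λ ≤ |e₀ kv|).card : ℝ) ≤ (L : ℝ) ^ 2 := by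
    have hcard : (Fintype.card (TorusSite 2 L) : ℝ) = (L : ℝ) ^ 2 := by
      rw [Fintype.card_pi, Fin.prod_const, ZMod.card]; push_cast; ring
    rw [← hcard]
    exact_mod_cast (card_le_card (filter_subset _ _)).trans (card_univ (α := TorusSite 2 L)).le
  have hcube := sum_inv_cube_le_of_count (ι := TorusSite 2 L) (fun kv => |e₀ kv|) hΛ (c₁V := c₁ * (L : ℝ) ^ 2) (C₂ := c₂ * L)
    (by positivity) (by positivity) J hJ hDOS
  have hcard : (Fintype.card (TorusSite 2 L) : ℝ) = (L : ℝ) ^ 2 := by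
    rw [Fintype.card_pi, Fin.prod_const, ZMod.card]; push_cast; ring
  rw [hcard] at hcube
  -- assemble
  have h1 : 8 * (2 * B₁ + 1) * c * fd * β / Λ * ((univ.filter fun kv : TorusSite 2 L => |e₀ kv| < 2 * Λ).card : ℝ) ≤
      c * fd * (16 * (2 * B₁ + 1) * β * (c₁ * (L : ℝ) ^ 2 + c₂ * L / (2 * Λ))) := by
    calc _ ≤ 8 * (2 * B₁ + 1) * c * fd * β / Λ * (c₁ * (L : ℝ) ^ 2 * (2 * Λ) + c₂ * L) := mul_le_mul_of_nonneg_left hnear (by positivity)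
      _ = c * fd * (16 * (2 * B₁ + 1) * β * (c₁ * (L : ℝ) ^ 2 + c₂ * L / (2 * Λ))) := by field_simp; ring
  have h2 : c * fd * (β ^ 2 / (2 * π ^ 2 * M)) * ((univ.filter fun kv : TorusSite 2 L => 2 * Λ ≤ |e₀ kv|).card : ℝ) ≤
      c * fd * ((L : ℝ) ^ 2 * β ^ 2 / (2 * π ^ 2 * M)) := by
    calc _ ≤ c * fd * (β ^ 2 / (2 * π ^ 2 * M)) * (L : ℝ) ^ 2 := mul_le_mul_of_nonneg_left hfarcount (by positivity)
      _ = _ := by ring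
  have h3 : c * fd * (16 * π ^ 2 / β) * ∑ kv : TorusSite 2 L, (if 2 * Λ ≤ |e₀ kv| then 1 / |e₀ kv| ^ 3 else 0) ≤
      c * fd * (16 * π ^ 2 / β) * (2 * (c₁ * (L : ℝ) ^ 2) / (3 * Λ ^ 2) + c₂ * L / (7 * Λ ^ 3) + (L : ℝ) ^ 2 / ((2 : ℝ) ^ (J + 1) * Λ) ^ 3) :=
    mul_le_mul_of_nonneg_left hcube (by positivity)
  have e1 : c * fd * (16 * (2 * B₁ + 1) * β * (c₁ * (L : ℝ) ^ 2 + c₂ * L / (2 * Λ)) + (L : ℝ) ^ 2 * β ^ 2 / (2 * π ^ 2 * M) +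
      16 * π ^ 2 / β * (2 * (c₁ * (L : ℝ) ^ 2) / (3 * Λ ^ 2) + c₂ * L / (7 * Λ ^ 3) + (L : ℝ) ^ 2 / ((2 : ℝ) ^ (J + 1) * Λ) ^ 3)) =
      c * fd * (16 * (2 * B₁ + 1) * β * (c₁ * (L : ℝ) ^ 2 + c₂ * L / (2 * Λ))) + c * fd * ((L : ℝ) ^ 2 * β ^ 2 / (2 * π ^ 2 * M)) +
      c * fd * (16 * π ^ 2 / β) * (2 * (c₁ * (L : ℝ) ^ 2) / (3 * Λ ^ 2) + c₂ * L / (7 * Λ ^ 3) + (L : ℝ) ^ 2 / ((2 : ℝ) ^ (J + 1) * Λ) ^ 3) := by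
    ring
  rw [hc] at e1 h1 h2 h3 ⊢
  linarith

end Model

end Summit.HubbardSuperconductivity.HubbardSuperconductivity.Theorems.EngineV8

end
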